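import Literature.IUT.LogThetaLattice.GlobalLGPFrobenioidsRealifiedModel
import Literature.IUT.HodgeArakelov.RealifiedPrimeStripSplitCategories
import HarnessLib

/-!
# [IUTchII] Def 4.9 (viii) / [IUTchI] Ex 3.5 (i), Def 5.2 (iv): the GENUINE categorical realified Frobenioid
# `(†𝓕⊛ℝ_𝔪𝔬𝔡)_α ≅ 𝒞^⊩_mod` as abc-iut-L6-t2's record `RealifiedGlobalFrobenioidF`, DEGREE-CLASSIFIED onto `ℝ`
# (junction file; model witness for the hypothesis of `HodgeArakelov/RealifiedPrimeStripSplitRigidity.lean`)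

abc-iut cell, layer L6, seat abc-iut-L6-t22 (gen 10); part of the disposition of the post-freeze row D-L6t22-R9F1a
(L6-lead §F v1.18e (3)/v1.18l/v1.18m (1); disposition RATIFIED §F v1.19i (1): (a′) closed by the proof-only
`HodgeArakelov/RealifiedPrimeStripSplitRigidity.lean`, (c′) = the model condition carried BY NAME with THIS file as its
genuine-model witness; a «post-freeze def» under the L6 reading (ii) of D-0067 (2)).  One definition (the junction
record) + elementary bookkeeping; nothing landed is re-typed.

PRINT. [IUTchI] Ex. 3.5 (i) p. 84: «`𝒞^⊩_mod` … the realification … of the Frobenioid of [FrdI], Example 6.3 …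
associated to the number field `F_mod` and the trivial Galois extension … the divisor monoid `Φ_{𝒞^⊩_mod}` … whose set
of primes … is in natural bijective correspondence with `V_mod` … the submonoid `Φ_{𝒞^⊩_mod,v}` … (`≅ ℝ_{≥0}`)»;
Rmk. 5.2.1 (ii) p. 143: «a collection, indexed by `V ⥲ V_mod`, of copies of the topological monoid `ℝ_{≥0}`, which are
related to one another by a "product formula"»; Def. 5.2 (iv) p. 135 (f): «isomorphic to the collection of data
`𝔉^⊩_mod`»; [IUTchII] Def. 4.9 (viii) p. 158 (`*𝒞^⊩` of an `F^{⊩▶×μ}`-prime-strip, its pilot object «of negative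
"arithmetic degree" [cf. [FrdI], Example 6.3; [FrdI], Theorem 6.4, (i), (ii)]»); [FrdI] Thm. 6.4 (i) p. 114: «`deg^arith_L`
determines an isomorphism of groups `δ_A : Pic_Φ(A) ⥲ ℝ`» (proof p. 115: Dirichlet unit theorem).
[claim: Mochizuki2012, status: disputed] for the IUT sentences; [cite: MochizukiFrdI2008, Thm. 6.4 (i) p.114].

WHAT THE TREE HAD. abc-iut-L6-t2's INTERFACE record `RealifiedGlobalFrobenioidF V` (`RealifiedPrimeStripsFinsupp.lean`:
objects, isomorphism relation, arithmetic degree `deg`, finitely supported local degrees `localDeg _ v` with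
`deg = ∑ᶠ_v localDeg`) and its isomorphism classes / `degClass` (`RealifiedPrimeStripSplitCategories.lean`); abc-iut-w5-d153's
GENUINE categorical realified Frobenioid of the number-field model `Prop37.FrakRlfCat F` ([FrdI] Prop. 5.3 model of
`(Φ^rlf, ℝ·Φ^birat)`; `GlobalLGPFrobenioidsRealifiedModel.lean`) with the classification
`FrakRlfCat.nonempty_iso_iff_frakDeg_eq` (isomorphic ⟺ equal arithmetic degree) and `FrakRlfCat.frakDeg_obj_surjective`
(every real number is a degree); abc-iut-L6-d3's degree `frakDeg 𝔍 = deg_F(frakDivisor 𝔍)` with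
`frakDivisor 𝔍 (p) = −placeMult(p)·[𝔍_{p}]` and campaign S's `degF = Σ_p c_p·degWeight(p)`.

WHAT THIS FILE ADDS.
* `Prop37.FrakRlfCat.realifiedGlobalFrobenioidF F : RealifiedGlobalFrobenioidF (ModelPlaces F)` — the junction record:
  objects = objects of `(†𝓕⊛ℝ_𝔪𝔬𝔡)_α`, `Iso X Y := Nonempty (X ≅ Y)` (isomorphism IN THE CATEGORY), `deg X := frakDeg X.obj`,
  `localDeg X v :=` the `v`-summand `frakDivisor(X.obj)(v)·degWeight(v)` of `deg_F` (so `deg = ∑ᶠ_v localDeg` is the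
  definition of `deg_F` re-indexed along `ModelPlaces F ≃ Place F`); simp lemmas `_deg`, `_iso_iff`, `_localDeg`;
* **`degClass_realifiedGlobalFrobenioidF_bijective`** — the genuine model is DEGREE-CLASSIFIED ONTO `ℝ` ([FrdI] Thm. 6.4
  (i) `δ_A : Pic_Φ(A) ⥲ ℝ` in the tree's currency): the hypothesis `Function.Bijective (·).degClass` of the rigidity /
  fullness theorems of `HodgeArakelov/RealifiedPrimeStripSplitRigidity.lean` HOLDS at the model print intends (Def 5.2
  (iv)(f)); `classOf_eq_iff_frakDeg_eq`.
NOT HERE (named): the `F^{⊩▶×μ}`-prime-strip over this record (local data `‡𝔉^{⊢▶×μ}_v` at the genuine places and the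
`ρ_v` with their `[K_v:(F_mod)_v]⁻¹` normalisation — abc-iut-L5-t2 `InitialThetaData.rho`, abc-iut-w5-d153
`FrakRlfCat.localDeg`; the places dictionary `ModelPlaces F_mod ↔ V̲`).  HONEST FRAMING: bookkeeping over the cell's own
typed records and classical algebraic number theory already in the tree; nothing here asserts a disputed claim or
takes a side on [IUTchIII] Cor. 3.12; typed ≠ proved; instantiated ≠ endorsed.
-/

noncomputable section

namespace Literature.IUT.LogThetaLattice

namespace Prop37

namespace FrakRlfCat

open CategoryTheory NumberField Literature.IUT.LogVolume Literature.IUT.LogThetaLattice.GlobalFrobenioidModels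
open Literature.IUT.HodgeArakelov

variable (F : Type) [Field F] [NumberField F]

/-- **The genuine categorical realified Frobenioid `(†𝓕⊛ℝ_𝔪𝔬𝔡)_α ≅ 𝒞^⊩_mod` as abc-iut-L6-t2's record
`RealifiedGlobalFrobenioidF`** over the places of `F` ([IUTchI] Ex. 3.5 (i) «`Prime(𝒞^⊩_mod) ⥲ V_mod`», [IUTchII] Def. 4.9
(viii) `*𝒞^⊩`): objects of the category, isomorphism = «isomorphic in `(†𝓕⊛ℝ_𝔪𝔬𝔡)_α`», arithmetic degree
`frakDeg`, local degree at `v` = the `v`-summand of `deg_F(frakDivisor −)`. [claim: Mochizuki2012, status: disputed] -/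
def realifiedGlobalFrobenioidF : RealifiedGlobalFrobenioidF.{0, 0} (ModelPlaces F) where
  Obj := FrakRlfCat F
  Iso X Y := Nonempty (X ≅ Y)
  iso_equivalence := ⟨fun X => ⟨Iso.refl X⟩, fun ⟨e⟩ => ⟨e.symm⟩, fun ⟨e⟩ ⟨e'⟩ => ⟨e ≪≫ e'⟩⟩
  deg X := frakDeg X.obj
  deg_iso _ _ := fun ⟨e⟩ => frakDeg_eq_of_iso e
  localDeg X v := frakDivisor X.obj v.swap * degWeight F v.swap
  localDeg_finite X := by
    refine ((frakDivisor X.obj).support.finite_toSet.image Sum.swap).subset fun v hv => ?_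
    refine ⟨v.swap, ?_, Sum.swap_swap v⟩
    rw [Finset.mem_coe, Finsupp.mem_support_iff]
    exact fun h => hv (by simp only [h, zero_mul])
  deg_eq_finsum X := by
    show degF F (frakDivisor X.obj) = ∑ᶠ v : ModelPlaces F, frakDivisor X.obj v.swap * degWeight F v.swap
    have hswap : (∑ᶠ v : ModelPlaces F, frakDivisor X.obj v.swap * degWeight F v.swap) =
        ∑ᶠ p : Place F, frakDivisor X.obj p * degWeight F p :=
      finsum_comp_equiv (Equiv.sumComm (IsDedekindDomain.HeightOneSpectrum (𝓞 F)) (InfinitePlace F))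
        (f := fun p : Place F => frakDivisor X.obj p * degWeight F p)
    rw [degF_apply, Finsupp.sum, hswap]
    symm
    refine finsum_eq_finsetSum_of_support_subset _ fun p hp => ?_
    rw [Finset.mem_coe, Finsupp.mem_support_iff]
    intro h
    apply hp
    show frakDivisor X.obj p * degWeight F p = 0
    rw [h, zero_mul]

/-- Objects of the junction record are the objects of `(†𝓕⊛ℝ_𝔪𝔬𝔡)_α`. [claim: Mochizuki2012, status: disputed] -/
theorem realifiedGlobalFrobenioidF_obj : (realifiedGlobalFrobenioidF F).Obj = FrakRlfCat F := rfl

variable {F}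

/-- Its isomorphism relation is «isomorphic in the category». [claim: Mochizuki2012, status: disputed] -/
@[simp] theorem realifiedGlobalFrobenioidF_iso_iff (X Y : FrakRlfCat F) :
    (realifiedGlobalFrobenioidF F).Iso X Y ↔ Nonempty (X ≅ Y) := Iff.rfl

/-- Its arithmetic degree is abc-iut-L6-d3's `frakDeg`. [claim: Mochizuki2012, status: disputed] -/
@[simp] theorem realifiedGlobalFrobenioidF_deg (X : FrakRlfCat F) :
    (realifiedGlobalFrobenioidF F).deg X = frakDeg X.obj := rfl

/-- Its local degree at `v` is the `v`-summand of `deg_F`: `frakDivisor(𝔍)(v) · degWeight(v)`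
(`= −placeMult(v)·[𝔍_v]·degWeight(v)`: `−[𝔍_v]·log q_v` at a finite place, `−[F_v:ℝ]·[𝔍_v]` at an archimedean one).
[claim: Mochizuki2012, status: disputed] -/
@[simp] theorem realifiedGlobalFrobenioidF_localDeg (X : FrakRlfCat F) (v : ModelPlaces F) :
    (realifiedGlobalFrobenioidF F).localDeg X v = frakDivisor X.obj v.swap * degWeight F v.swap := rfl

/-- The local degree in the model's own coordinates: `−placeMult(v)·[𝔍_v]·degWeight(v)`.
[claim: Mochizuki2012, status: disputed] -/
theorem realifiedGlobalFrobenioidF_localDeg_eq (X : FrakRlfCat F) (v : ModelPlaces F) :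
    (realifiedGlobalFrobenioidF F).localDeg X v = -(placeMult v.swap * X.obj.cls v) * degWeight F v.swap := by
  rw [realifiedGlobalFrobenioidF_localDeg, frakDivisor_apply, Sum.swap_swap]

/-- Two objects have the same isomorphism class in the junction record iff they have the same arithmetic degree
(abc-iut-w5-d153's classification `nonempty_iso_iff_frakDeg_eq`). [cite: MochizukiFrdI2008, Thm. 6.4 (i) p.114] -/
theorem classOf_eq_iff_frakDeg_eq (X Y : FrakRlfCat F) :
    (realifiedGlobalFrobenioidF F).classOf X = (realifiedGlobalFrobenioidF F).classOf Y ↔ frakDeg X.obj = frakDeg Y.obj := by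
  rw [RealifiedGlobalFrobenioidF.classOf_eq_classOf_iff, realifiedGlobalFrobenioidF_iso_iff, nonempty_iso_iff_frakDeg_eq]

variable (F)

/-- **The genuine categorical realified Frobenioid is DEGREE-CLASSIFIED ONTO `ℝ`** — [FrdI] Thm. 6.4 (i) «`δ_A : Pic_Φ(A) ⥲ ℝ`»
in abc-iut-L6-t2's currency: `degClass : IsoClass(*𝒞^⊩) → ℝ` is a BIJECTION (injective: `nonempty_iso_iff_frakDeg_eq`;
surjective: `frakDeg_obj_surjective`).  This is the hypothesis of the rigidity/fullness theorems of
`HodgeArakelov/RealifiedPrimeStripSplitRigidity.lean` at the model print intends. [cite: MochizukiFrdI2008, Thm. 6.4 (i) p.114] -/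
theorem degClass_realifiedGlobalFrobenioidF_bijective :
    Function.Bijective (realifiedGlobalFrobenioidF F).degClass := by
  constructor
  · intro a b
    induction a using Quotient.inductionOn with
    | h X =>
      induction b using Quotient.inductionOn with
      | h Y =>
        intro h
        exact Quotient.sound ((nonempty_iso_iff_frakDeg_eq X Y).mpr h)
  · intro r
    obtain ⟨X, hX⟩ := frakDeg_obj_surjective (F := F) r
    exact ⟨(realifiedGlobalFrobenioidF F).classOf X, hX⟩

/-- Hence the isomorphism classes of `(†𝓕⊛ℝ_𝔪𝔬𝔡)_α` are in bijection with `ℝ` by the degree (the tree's `δ_∗`).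
[cite: MochizukiFrdI2008, Thm. 6.4 (i) p.114] -/
theorem nonempty_isoClass_equiv_real :
    ∃ δ : (realifiedGlobalFrobenioidF F).IsoClass ≃ ℝ, ∀ X : FrakRlfCat F,
      δ ((realifiedGlobalFrobenioidF F).classOf X) = frakDeg X.obj :=
  ⟨Equiv.ofBijective _ (degClass_realifiedGlobalFrobenioidF_bijective F), fun _ => rfl⟩

end FrakRlfCat

end Prop37

end Literature.IUT.LogThetaLattice

end
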